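import Mathlib
import Summits.NavierStokesRegularity.NavierStokesRegularity.Theorems.PlaneEnergyCeilingPlanarEnergyAPrioriLadyzhenskaya
import Summits.NavierStokesRegularity.NavierStokesRegularity.Theorems.PlaneEnergyCeilingPlanarEnergyAPrioriFluxDifference
import Summits.NavierStokesRegularity.NavierStokesRegularity.Theorems.PlaneEnergyCeilingPlanarEnergyAPrioriPressureGradient

/-!
# Route PlaneEnergyCeiling · crux `PlanarEnergyAPriori` — THE FLUX VARIATION BOUND (F1)

Helper file for the crux item stmt-NavierStokesRegularity-16855 (`PlanarEnergyAPriori`), landed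
`--supports` that item: the judge's "lemma bounding the slab Bernoulli flux by planar energy and
dissipation" (strategist census gen 1, A-S6 (F1)), UNCONDITIONAL. For a `C⁴` divergence-free field
`u` on `ℝ³` with order-3 decay of `u`, `Du`, and a `C¹` scalar `p` with order-2 decay of `p − π₀`,
`Dp` that IS the Riesz-transform pressure of `u` up to a constant (`p = p̃[u] + c`), the Bernoulli
fluxes `F(R,c) = ∫_{R({x₂=c})} (|u|²/2 + p)⟪u, R e₂⟫ dA` satisfy, for every direction `R` and all
offsets `a, b`,

  `‖F(R,a) − F(R,b)‖ ≤ K_F · √(sup_c E(u;R,c)) · ∫ ‖Du‖²`,      `E(u;R,c) = ∫_{ℝ²} ‖u(R(y₀,y₁,c))‖² dy`,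

with a universal `K_F < ∞` (registered sub-goal `fluxVariationBound`). Assembly of the three
landed inputs: `‖F(R,a) − F(R,b)‖ ≤ ∫‖u‖²‖Du‖ + ∫‖u‖‖Dp‖` (flux difference, with the pressure
constant removed by the zero net flux `∫_Π ⟪u, Re₂⟫ = 0`), Hölder, the slice-wise Ladyzhenskaya
inequality `∫‖u‖⁴ ≤ P_R ∫‖Du‖²`, and the Calderón–Zygmund bound `‖Dp̃[u]‖_{4/3} ≤ K ‖u‖₄ ‖Du‖₂`:
`∫‖u‖²‖Du‖ ≤ ‖u‖₄² ‖Du‖₂ ≤ √P_R Z` and `∫‖u‖‖Dp‖ ≤ ‖u‖₄ ‖Dp‖_{4/3} ≤ K ‖u‖₄² ‖Du‖₂ ≤ K √P_R Z`.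
The exponent `1/2` on the planar ceiling is scaling-sharp (census (F3)). Inserted in the mild slab
law it yields the dynamic planar ceiling `P(t) ≤ 2P(0) + C W(t)²/ν` (census (F2)).
-/

noncomputable section

-- single-conjunct summit: `Summit.<Summit>.<Problem>` repeats the name by the D-0017 layout
set_option linter.dupNamespace false

namespace Summit.NavierStokesRegularity.NavierStokesRegularity.Theorems.PlanarEnergyAPriori

open MeasureTheory Set Filter Topology Function WithLp
open scoped ENNReal NNReal RealInnerProductSpace
open Literature.Analysis.FluidPDE
open Summit.NavierStokesRegularity.NavierStokesRegularity.Theorems.PlaneEnergyCeilingSlabEnergyIdentity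
open Summit.NavierStokesRegularity.NavierStokesRegularity.Theorems.PlanarEnergyAPriori.SlabLaw

variable {u : EuclideanSpace ℝ (Fin 3) → EuclideanSpace ℝ (Fin 3)} {C : ℝ}

/-! ### `L^p` membership under order-3 decay -/

/-- A continuous field with `‖u‖ ≤ C(1+‖x‖)⁻³` is in `L²`. -/
theorem memLp_two_of_decay (hu : Continuous u) (h0 : ∀ x, ‖u x‖ ≤ C * (1 + ‖x‖) ^ (-(3 : ℝ))) :
    MemLp u 2 volume :=
  (memLp_two_iff_integrable_sq_norm hu.aestronglyMeasurable).2 (integrable_norm_sq hu h0)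

/-- A continuous field with `‖u‖ ≤ C(1+‖x‖)⁻³` is in `L⁴`. -/
theorem memLp_four_of_decay (hu : Continuous u) (h0 : ∀ x, ‖u x‖ ≤ C * (1 + ‖x‖) ^ (-(3 : ℝ))) :
    MemLp u 4 volume := by
  have hC : 0 ≤ C := nonneg_of_norm_le_rpow h0
  have hint : Integrable (fun x => ‖u x‖ ^ (4 : ℝ≥0∞).toReal) volume := by
    rw [ENNReal.toReal_ofNat]
    have hcont : Continuous fun x => ‖u x‖ ^ (4 : ℝ) := hu.norm.rpow_const fun _ => Or.inr (by norm_num)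
    refine integrable_of_norm_le_rpow (C := C ^ 4) hcont (by norm_num : (3 : ℝ) < 12) fun x => ?_
    rw [Real.norm_of_nonneg (by positivity), show (4 : ℝ) = ((4 : ℕ) : ℝ) by norm_num, Real.rpow_natCast]
    calc ‖u x‖ ^ 4 ≤ (C * (1 + ‖x‖) ^ (-(3 : ℝ))) ^ 4 := pow_le_pow_left₀ (norm_nonneg _) (h0 x) 4
      _ = C ^ 4 * (1 + ‖x‖) ^ (-(12 : ℝ)) := by
          rw [mul_pow, ← Real.rpow_natCast ((1 + ‖x‖) ^ (-(3 : ℝ))), ← Real.rpow_mul (by positivity)]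
          norm_num
  exact (integrable_norm_rpow_iff hu.aestronglyMeasurable (by norm_num) (by norm_num)).1 hint

/-- Finite energy in `ℝ≥0∞` form: `∫ ‖u‖ₑ² < ∞`. -/
theorem lintegral_enorm_sq_lt_top_of_decay (hu : Continuous u) (h0 : ∀ x, ‖u x‖ ≤ C * (1 + ‖x‖) ^ (-(3 : ℝ))) :
    ∫⁻ x, ‖u x‖ₑ ^ 2 < ∞ := by
  have h := lintegral_rpow_enorm_lt_top_of_eLpNorm_lt_top two_ne_zero ENNReal.ofNat_ne_top
    (memLp_two_of_decay hu h0).eLpNorm_lt_top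
  simpa [ENNReal.toReal_ofNat] using h

/-! ### `eLpNorm`s as `rpow`s of `lintegral`s -/

/-- `‖f‖_{L⁴} = (∫ ‖f‖ₑ⁴)^{1/4}`. -/
theorem eLpNorm_four_eq {X : Type*} [NormedAddCommGroup X] (f : EuclideanSpace ℝ (Fin 3) → X) :
    eLpNorm f 4 volume = (∫⁻ x, ‖f x‖ₑ ^ 4) ^ (1 / 4 : ℝ) := by
  rw [eLpNorm_eq_lintegral_rpow_enorm_toReal (by norm_num) ENNReal.ofNat_ne_top, ENNReal.toReal_ofNat]
  congr 1
  refine lintegral_congr fun x => ?_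
  rw [show (4 : ℝ) = ((4 : ℕ) : ℝ) by norm_num, ENNReal.rpow_natCast]

/-- `‖f‖_{L²} = (∫ ‖f‖ₑ²)^{1/2}`. -/
theorem eLpNorm_two_eq' {X : Type*} [NormedAddCommGroup X] (f : EuclideanSpace ℝ (Fin 3) → X) :
    eLpNorm f 2 volume = (∫⁻ x, ‖f x‖ₑ ^ 2) ^ (1 / 2 : ℝ) := by
  rw [eLpNorm_eq_lintegral_rpow_enorm_toReal two_ne_zero ENNReal.ofNat_ne_top, ENNReal.toReal_ofNat]
  congr 1
  refine lintegral_congr fun x => ?_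
  rw [ENNReal.rpow_two]

/-- `‖f‖_{L^{4/3}} = (∫ ‖f‖ₑ^{4/3})^{3/4}`. -/
theorem eLpNorm_fourThirds_eq {X : Type*} [NormedAddCommGroup X] (f : EuclideanSpace ℝ (Fin 3) → X) :
    eLpNorm f (4 / 3) volume = (∫⁻ x, ‖f x‖ₑ ^ (4 / 3 : ℝ)) ^ (3 / 4 : ℝ) := by
  have h43 : ((4 / 3 : ℝ≥0∞)).toReal = 4 / 3 := by
    rw [ENNReal.toReal_div]; norm_num
  rw [eLpNorm_eq_lintegral_rpow_enorm_toReal (one_lt_fourThirds.1.ne_bot) one_lt_fourThirds.2.ne, h43]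
  norm_num

/-! ### The two volume integrals under the planar ceiling -/

/-- **`∫ ‖u‖² ‖Du‖ ≤ √(P_R) · Z`** (`Z = ∫ ‖Du‖²`): Cauchy–Schwarz and slice-wise Ladyzhenskaya. -/
theorem lintegral_sq_mul_fderiv_le (hu : ContDiff ℝ 1 u) (hL2 : ∫⁻ x, ‖u x‖ₑ ^ 2 < ∞)
    (R : EuclideanSpace ℝ (Fin 3) ≃ₗᵢ[ℝ] EuclideanSpace ℝ (Fin 3)) :
    ∫⁻ x, ‖u x‖ₑ ^ 2 * ‖fderiv ℝ u x‖ₑ ≤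
      (⨆ c : ℝ, ∫⁻ y : EuclideanSpace ℝ (Fin 2), ‖u (R (toLp 2 ![y 0, y 1, c]))‖ₑ ^ 2) ^ (1 / 2 : ℝ) *
        ∫⁻ x, ‖fderiv ℝ u x‖ₑ ^ 2 := by
  set P : ℝ≥0∞ := ⨆ c : ℝ, ∫⁻ y : EuclideanSpace ℝ (Fin 2), ‖u (R (toLp 2 ![y 0, y 1, c]))‖ₑ ^ 2 with hP
  set Z : ℝ≥0∞ := ∫⁻ x, ‖fderiv ℝ u x‖ₑ ^ 2 with hZ
  have hf : AEMeasurable (fun x => ‖u x‖ₑ ^ 2) volume :=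
    ((continuous_enorm.comp hu.continuous).measurable.pow_const 2).aemeasurable
  have hg : AEMeasurable (fun x => ‖fderiv ℝ u x‖ₑ) volume :=
    (continuous_enorm.comp (hu.continuous_fderiv one_ne_zero)).measurable.aemeasurable
  have hH := ENNReal.lintegral_mul_le_Lp_mul_Lq volume Real.HolderConjugate.two_two hf hg
  have hLady := lintegral_enorm_pow_four_le_iSup_planarEnergy_mul' hu hL2 R
  have h4 : ∫⁻ x, (‖u x‖ₑ ^ 2) ^ (2 : ℝ) = ∫⁻ x, ‖u x‖ₑ ^ 4 :=
    lintegral_congr fun x => by rw [ENNReal.rpow_two, ← pow_mul]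
  calc ∫⁻ x, ‖u x‖ₑ ^ 2 * ‖fderiv ℝ u x‖ₑ
      ≤ (∫⁻ x, (‖u x‖ₑ ^ 2) ^ (2 : ℝ)) ^ (1 / (2 : ℝ)) * (∫⁻ x, ‖fderiv ℝ u x‖ₑ ^ (2 : ℝ)) ^ (1 / (2 : ℝ)) := hH
    _ = (∫⁻ x, ‖u x‖ₑ ^ 4) ^ (1 / (2 : ℝ)) * Z ^ (1 / (2 : ℝ)) := by
        rw [h4, hZ]; simp_rw [ENNReal.rpow_two]
    _ ≤ (P * Z) ^ (1 / (2 : ℝ)) * Z ^ (1 / (2 : ℝ)) := by gcongr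
    _ = P ^ (1 / 2 : ℝ) * Z := by
        rw [ENNReal.mul_rpow_of_nonneg _ _ (by norm_num), mul_assoc, ← ENNReal.rpow_add_of_nonneg _ _ (by norm_num) (by norm_num)]
        norm_num

/-- **`∫ ‖u‖ ‖Dp̃[u]‖ ≤ K √(P_R) · Z`**: Hölder `L⁴ × L^{4/3}`, the Calderón–Zygmund bound
`‖Dp̃[u]‖_{4/3} ≤ K‖u‖₄‖Du‖₂`, and slice-wise Ladyzhenskaya `‖u‖₄² ≤ √(P_R Z)`. -/
theorem lintegral_mul_fderiv_normalisedPressure_le {K : ℝ≥0∞}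
    (hK : ∀ (w : EuclideanSpace ℝ (Fin 3) → EuclideanSpace ℝ (Fin 3)), ContDiff ℝ 4 w →
      MemLp w 2 volume → MemLp w 4 volume →
        eLpNorm (fun x => fderiv ℝ (normalisedPressure w) x) (4 / 3) volume ≤
          K * eLpNorm w 4 volume * eLpNorm (fun x => fderiv ℝ w x) 2 volume)
    (hu : ContDiff ℝ 4 u) (h0 : ∀ x, ‖u x‖ ≤ C * (1 + ‖x‖) ^ (-(3 : ℝ)))
    (R : EuclideanSpace ℝ (Fin 3) ≃ₗᵢ[ℝ] EuclideanSpace ℝ (Fin 3)) :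
    ∫⁻ x, ‖u x‖ₑ * ‖fderiv ℝ (normalisedPressure u) x‖ₑ ≤
      K * (⨆ c : ℝ, ∫⁻ y : EuclideanSpace ℝ (Fin 2), ‖u (R (toLp 2 ![y 0, y 1, c]))‖ₑ ^ 2) ^ (1 / 2 : ℝ) *
        ∫⁻ x, ‖fderiv ℝ u x‖ₑ ^ 2 := by
  set P : ℝ≥0∞ := ⨆ c : ℝ, ∫⁻ y : EuclideanSpace ℝ (Fin 2), ‖u (R (toLp 2 ![y 0, y 1, c]))‖ₑ ^ 2 with hP
  set Z : ℝ≥0∞ := ∫⁻ x, ‖fderiv ℝ u x‖ₑ ^ 2 with hZ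
  have huc : Continuous u := hu.continuous
  have hu1 : ContDiff ℝ 1 u := hu.of_le (by norm_num)
  have h2 : MemLp u 2 volume := memLp_two_of_decay huc h0
  have h4 : MemLp u 4 volume := memLp_four_of_decay huc h0
  have hL2 : ∫⁻ x, ‖u x‖ₑ ^ 2 < ∞ := lintegral_enorm_sq_lt_top_of_decay huc h0
  have hq2 : ContDiff ℝ 2 (normalisedPressure u) := contDiff_two_normalisedPressure hu h2
  -- Hölder `L⁴ × L^{4/3}`
  have hpq : Real.HolderConjugate 4 (4 / 3) := ⟨by norm_num, by norm_num, by norm_num⟩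
  have hf : AEMeasurable (fun x => ‖u x‖ₑ) volume := (continuous_enorm.comp huc).measurable.aemeasurable
  have hg : AEMeasurable (fun x => ‖fderiv ℝ (normalisedPressure u) x‖ₑ) volume :=
    (continuous_enorm.comp (hq2.continuous_fderiv (by norm_num))).measurable.aemeasurable
  have hH := ENNReal.lintegral_mul_le_Lp_mul_Lq volume hpq hf hg
  -- the Calderón–Zygmund bound, in `lintegral` form
  have hCZ := hK u hu h2 h4
  rw [eLpNorm_fourThirds_eq, eLpNorm_four_eq, eLpNorm_two_eq'] at hCZ
  -- slice-wise Ladyzhenskaya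
  have hLady := lintegral_enorm_pow_four_le_iSup_planarEnergy_mul' hu1 hL2 R
  have hsq : ((∫⁻ x, ‖u x‖ₑ ^ 4) ^ (1 / 4 : ℝ)) * (∫⁻ x, ‖u x‖ₑ ^ 4) ^ (1 / 4 : ℝ) =
      (∫⁻ x, ‖u x‖ₑ ^ 4) ^ (1 / 2 : ℝ) := by
    rw [← ENNReal.rpow_add_of_nonneg _ _ (by norm_num) (by norm_num)]; norm_num
  calc ∫⁻ x, ‖u x‖ₑ * ‖fderiv ℝ (normalisedPressure u) x‖ₑ
      ≤ (∫⁻ x, ‖u x‖ₑ ^ (4 : ℝ)) ^ (1 / (4 : ℝ)) *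
          (∫⁻ x, ‖fderiv ℝ (normalisedPressure u) x‖ₑ ^ (4 / 3 : ℝ)) ^ (1 / (4 / 3 : ℝ)) := hH
    _ = (∫⁻ x, ‖u x‖ₑ ^ 4) ^ (1 / 4 : ℝ) *
          (∫⁻ x, ‖fderiv ℝ (normalisedPressure u) x‖ₑ ^ (4 / 3 : ℝ)) ^ (3 / 4 : ℝ) := by
        congr 2
        · refine lintegral_congr fun x => ?_
          rw [show (4 : ℝ) = ((4 : ℕ) : ℝ) by norm_num, ENNReal.rpow_natCast]
        · norm_num
    _ ≤ (∫⁻ x, ‖u x‖ₑ ^ 4) ^ (1 / 4 : ℝ) *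
          (K * (∫⁻ x, ‖u x‖ₑ ^ 4) ^ (1 / 4 : ℝ) * (∫⁻ x, ‖fderiv ℝ u x‖ₑ ^ 2) ^ (1 / 2 : ℝ)) := by
        gcongr
    _ = K * (((∫⁻ x, ‖u x‖ₑ ^ 4) ^ (1 / 4 : ℝ)) * (∫⁻ x, ‖u x‖ₑ ^ 4) ^ (1 / 4 : ℝ)) * Z ^ (1 / 2 : ℝ) := by
        rw [hZ]; ring
    _ = K * (∫⁻ x, ‖u x‖ₑ ^ 4) ^ (1 / 2 : ℝ) * Z ^ (1 / 2 : ℝ) := by rw [hsq]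
    _ ≤ K * (P * Z) ^ (1 / 2 : ℝ) * Z ^ (1 / 2 : ℝ) := by gcongr
    _ = K * P ^ (1 / 2 : ℝ) * Z := by
        rw [ENNReal.mul_rpow_of_nonneg _ _ (by norm_num), mul_assoc, mul_assoc,
          ← ENNReal.rpow_add_of_nonneg _ _ (by norm_num) (by norm_num)]
        norm_num; ring

/-! ### Removing the pressure constant: zero net flux -/

/-- The flux density with the pressure constant removed is integrable on every plane. -/
theorem integrable_plane_bernoulli_inner {p : EuclideanSpace ℝ (Fin 3) → ℝ} {π₀ : ℝ} (hu : Continuous u)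
    (hp : Continuous p) (h0 : ∀ x, ‖u x‖ ≤ C * (1 + ‖x‖) ^ (-(3 : ℝ)))
    (k0 : ∀ x, ‖p x - π₀‖ ≤ C * (1 + ‖x‖) ^ (-(2 : ℝ)))
    (R : EuclideanSpace ℝ (Fin 3) ≃ₗᵢ[ℝ] EuclideanSpace ℝ (Fin 3)) (c : ℝ) :
    Integrable fun y : EuclideanSpace ℝ (Fin 2) =>
      (‖u (R (toLp 2 ![y 0, y 1, c]))‖ ^ 2 / 2 + (p (R (toLp 2 ![y 0, y 1, c])) - π₀)) *
        ⟪u (R (toLp 2 ![y 0, y 1, c])), R (EuclideanSpace.single 2 1)⟫ := by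
  have hC : 0 ≤ C := nonneg_of_norm_le_rpow h0
  set g : EuclideanSpace ℝ (Fin 3) → ℝ := fun x =>
    (‖u (R x)‖ ^ 2 / 2 + (p (R x) - π₀)) * ⟪u (R x), R (EuclideanSpace.single 2 1)⟫ with hg
  have hgc : Continuous g := by
    rw [hg]
    exact (((hu.comp R.continuous).norm.pow 2).div_const 2 |>.add ((hp.comp R.continuous).sub continuous_const)).mul
      ((hu.comp R.continuous).inner continuous_const)
  have hbound : ∀ x, ‖g x‖ ≤ (C ^ 2 / 2 + C) * C * (1 + ‖x‖) ^ (-(5 : ℝ)) := fun x => by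
    have hθ := norm_bernoulli_le_weight (u := u) (p := fun z => p z - π₀) (h0 (R x)) (k0 (R x))
    have hin : ‖⟪u (R x), R (EuclideanSpace.single 2 1)⟫‖ ≤ C * (1 + ‖x‖) ^ (-(3 : ℝ)) := by
      calc _ ≤ ‖u (R x)‖ * ‖R (EuclideanSpace.single 2 1)‖ := norm_inner_le_norm _ _
        _ = ‖u (R x)‖ := by rw [LinearIsometryEquiv.norm_map]; simp
        _ ≤ C * (1 + ‖x‖) ^ (-(3 : ℝ)) := by simpa [LinearIsometryEquiv.norm_map] using h0 (R x)
    rw [hg]; dsimp only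
    rw [norm_mul]
    calc _ ≤ ((C ^ 2 / 2 + C) * (1 + ‖R x‖) ^ (-(2 : ℝ))) * (C * (1 + ‖x‖) ^ (-(3 : ℝ))) :=
          mul_le_mul hθ hin (norm_nonneg _) (by positivity)
      _ = (C ^ 2 / 2 + C) * C * (1 + ‖x‖) ^ (-(5 : ℝ)) := by
          rw [LinearIsometryEquiv.norm_map, mul_mul_mul_comm, weight_two_mul_three]
  exact integrable_plane_of_norm_le_rpow hgc (by norm_num : (2 : ℝ) < 5) hbound c

/-- **The pressure constant is invisible to flux differences** (zero net flux `∫_Π ⟪u, R e₂⟫ = 0`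
through every plane of a decaying divergence-free field): with `p = (p − π₀) + π₀`,
`F_p(R,a) − F_p(R,b) = F_{p−π₀}(R,a) − F_{p−π₀}(R,b)`. -/
theorem bernoulliFlux_sub_eq_of_sub_const {p : EuclideanSpace ℝ (Fin 3) → ℝ} (hu : ContDiff ℝ 1 u)
    (hp : Continuous p) (hdiv : VectorCalculus.IsDivFree u)
    (h0 : ∀ x, ‖u x‖ ≤ C * (1 + ‖x‖) ^ (-(3 : ℝ))) (h1 : ∀ x, ‖fderiv ℝ u x‖ ≤ C * (1 + ‖x‖) ^ (-(3 : ℝ)))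
    (π₀ : ℝ) (k0 : ∀ x, ‖p x - π₀‖ ≤ C * (1 + ‖x‖) ^ (-(2 : ℝ)))
    (R : EuclideanSpace ℝ (Fin 3) ≃ₗᵢ[ℝ] EuclideanSpace ℝ (Fin 3)) (a b : ℝ) :
    (∫ y : EuclideanSpace ℝ (Fin 2), (‖u (R (toLp 2 ![y 0, y 1, a]))‖ ^ 2 / 2 + p (R (toLp 2 ![y 0, y 1, a]))) *
        ⟪u (R (toLp 2 ![y 0, y 1, a])), R (EuclideanSpace.single 2 1)⟫) -
      ∫ y : EuclideanSpace ℝ (Fin 2), (‖u (R (toLp 2 ![y 0, y 1, b]))‖ ^ 2 / 2 + p (R (toLp 2 ![y 0, y 1, b]))) *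
        ⟪u (R (toLp 2 ![y 0, y 1, b])), R (EuclideanSpace.single 2 1)⟫ =
    (∫ y : EuclideanSpace ℝ (Fin 2), (‖u (R (toLp 2 ![y 0, y 1, a]))‖ ^ 2 / 2 + (p (R (toLp 2 ![y 0, y 1, a])) - π₀)) *
        ⟪u (R (toLp 2 ![y 0, y 1, a])), R (EuclideanSpace.single 2 1)⟫) -
      ∫ y : EuclideanSpace ℝ (Fin 2), (‖u (R (toLp 2 ![y 0, y 1, b]))‖ ^ 2 / 2 + (p (R (toLp 2 ![y 0, y 1, b])) - π₀)) *
        ⟪u (R (toLp 2 ![y 0, y 1, b])), R (EuclideanSpace.single 2 1)⟫ := by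
  have hsplit : ∀ c, (∫ y : EuclideanSpace ℝ (Fin 2), (‖u (R (toLp 2 ![y 0, y 1, c]))‖ ^ 2 / 2 + p (R (toLp 2 ![y 0, y 1, c]))) *
        ⟪u (R (toLp 2 ![y 0, y 1, c])), R (EuclideanSpace.single 2 1)⟫) =
      (∫ y : EuclideanSpace ℝ (Fin 2), (‖u (R (toLp 2 ![y 0, y 1, c]))‖ ^ 2 / 2 + (p (R (toLp 2 ![y 0, y 1, c])) - π₀)) *
        ⟪u (R (toLp 2 ![y 0, y 1, c])), R (EuclideanSpace.single 2 1)⟫) +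
      π₀ * ∫ y : EuclideanSpace ℝ (Fin 2), ⟪u (R (toLp 2 ![y 0, y 1, c])), R (EuclideanSpace.single 2 1)⟫ := by
    intro c
    have hI1 := integrable_plane_bernoulli_inner hu.continuous hp h0 k0 R c
    have hI2 : Integrable fun y : EuclideanSpace ℝ (Fin 2) =>
        π₀ * ⟪u (R (toLp 2 ![y 0, y 1, c])), R (EuclideanSpace.single 2 1)⟫ := by
      refine Integrable.const_mul ?_ π₀
      have hgc : Continuous fun x : EuclideanSpace ℝ (Fin 3) => ⟪u (R x), R (EuclideanSpace.single 2 1)⟫ :=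
        (hu.continuous.comp R.continuous).inner continuous_const
      refine integrable_plane_of_norm_le_rpow (C := C) hgc (by norm_num : (2 : ℝ) < 3) (fun x => ?_) c
      calc _ ≤ ‖u (R x)‖ * ‖R (EuclideanSpace.single 2 1)‖ := norm_inner_le_norm _ _
        _ = ‖u (R x)‖ := by rw [LinearIsometryEquiv.norm_map]; simp
        _ ≤ C * (1 + ‖x‖) ^ (-(3 : ℝ)) := by simpa [LinearIsometryEquiv.norm_map] using h0 (R x)
    rw [← integral_const_mul, ← integral_add hI1 hI2]
    refine integral_congr_ae (ae_of_all _ fun y => ?_)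
    ring
  rw [hsplit a, hsplit b, integral_plane_inner_isometry_eq_zero hu hdiv h0 h1 R a,
    integral_plane_inner_isometry_eq_zero hu hdiv h0 h1 R b]
  ring

/-! ### The flux variation bound -/

/-- **THE FLUX VARIATION BOUND** (section form, with the Calderón–Zygmund constant `K` as a
hypothesis on the pressure-gradient bound): for `C⁴` divergence-free `u` with order-3 decay of
`u`, `Du`, and `C¹` `p` with order-2 decay of `p − π₀`, `Dp`, which is the Riesz-transform pressure
of `u` up to a constant, every direction `R` and all offsets `a, b`:
`‖F(R,a) − F(R,b)‖ ≤ (1 + K) √(sup_c E(u;R,c)) ∫‖Du‖²`. [folklore; RRS2016 Lemma 5.1] -/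
theorem enorm_bernoulliFlux_sub_le_sqrt_planarCeiling_mul {K : ℝ≥0∞}
    (hK : ∀ (w : EuclideanSpace ℝ (Fin 3) → EuclideanSpace ℝ (Fin 3)), ContDiff ℝ 4 w →
      MemLp w 2 volume → MemLp w 4 volume →
        eLpNorm (fun x => fderiv ℝ (normalisedPressure w) x) (4 / 3) volume ≤
          K * eLpNorm w 4 volume * eLpNorm (fun x => fderiv ℝ w x) 2 volume)
    {p : EuclideanSpace ℝ (Fin 3) → ℝ} {π₀ : ℝ} (hu : ContDiff ℝ 4 u) (hp : ContDiff ℝ 1 p)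
    (hdiv : VectorCalculus.IsDivFree u)
    (h0 : ∀ x, ‖u x‖ ≤ C * (1 + ‖x‖) ^ (-(3 : ℝ))) (h1 : ∀ x, ‖fderiv ℝ u x‖ ≤ C * (1 + ‖x‖) ^ (-(3 : ℝ)))
    (k0 : ∀ x, ‖p x - π₀‖ ≤ C * (1 + ‖x‖) ^ (-(2 : ℝ))) (k1 : ∀ x, ‖fderiv ℝ p x‖ ≤ C * (1 + ‖x‖) ^ (-(2 : ℝ)))
    (hid : ∃ c₀ : ℝ, ∀ x, p x = normalisedPressure u x + c₀)
    (R : EuclideanSpace ℝ (Fin 3) ≃ₗᵢ[ℝ] EuclideanSpace ℝ (Fin 3)) (a b : ℝ) :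
    ‖(∫ y : EuclideanSpace ℝ (Fin 2), (‖u (R (toLp 2 ![y 0, y 1, a]))‖ ^ 2 / 2 + p (R (toLp 2 ![y 0, y 1, a]))) *
        ⟪u (R (toLp 2 ![y 0, y 1, a])), R (EuclideanSpace.single 2 1)⟫) -
      ∫ y : EuclideanSpace ℝ (Fin 2), (‖u (R (toLp 2 ![y 0, y 1, b]))‖ ^ 2 / 2 + p (R (toLp 2 ![y 0, y 1, b]))) *
        ⟪u (R (toLp 2 ![y 0, y 1, b])), R (EuclideanSpace.single 2 1)⟫‖ₑ ≤
      (1 + K) * (⨆ c : ℝ, ∫⁻ y : EuclideanSpace ℝ (Fin 2), ‖u (R (toLp 2 ![y 0, y 1, c]))‖ₑ ^ 2) ^ (1 / 2 : ℝ) *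
        ∫⁻ x, ‖fderiv ℝ u x‖ₑ ^ 2 := by
  have hu1 : ContDiff ℝ 1 u := hu.of_le (by norm_num)
  have hL2 : ∫⁻ x, ‖u x‖ₑ ^ 2 < ∞ := lintegral_enorm_sq_lt_top_of_decay hu.continuous h0
  obtain ⟨c₀, hc₀⟩ := hid
  -- the normalised pressure `p' = p − π₀`
  set p' : EuclideanSpace ℝ (Fin 3) → ℝ := fun x => p x - π₀ with hp'
  have hp'1 : ContDiff ℝ 1 p' := hp.sub contDiff_const
  have hDp' : ∀ x, fderiv ℝ p' x = fderiv ℝ p x := fun x => fderiv_sub_const' p π₀ x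
  have hDp : ∀ x, fderiv ℝ p x = fderiv ℝ (normalisedPressure u) x := fun x => by
    have : p = fun z => normalisedPressure u z + c₀ := funext hc₀
    rw [this, fderiv_add_const]
  have k0' : ∀ x, ‖p' x‖ ≤ C * (1 + ‖x‖) ^ (-(2 : ℝ)) := fun x => k0 x
  have k1' : ∀ x, ‖fderiv ℝ p' x‖ ≤ C * (1 + ‖x‖) ^ (-(2 : ℝ)) := fun x => by rw [hDp']; exact k1 x
  rw [bernoulliFlux_sub_eq_of_sub_const hu1 hp.continuous hdiv h0 h1 π₀ k0 R a b]
  have hB := enorm_bernoulliFlux_sub_le hu1 hp'1 hdiv h0 h1 k0' k1' R a b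
  refine hB.trans ?_
  have hI2 : ∫⁻ x, ‖u x‖ₑ * ‖fderiv ℝ p' x‖ₑ = ∫⁻ x, ‖u x‖ₑ * ‖fderiv ℝ (normalisedPressure u) x‖ₑ :=
    lintegral_congr fun x => by rw [hDp', hDp]
  rw [hI2, add_mul, add_mul, one_mul]
  exact add_le_add (lintegral_sq_mul_fderiv_le hu1 hL2 R) (lintegral_mul_fderiv_normalisedPressure_le hK hu h0 R)

/-- **THE FLUX VARIATION BOUND** (registered closed form, sub-goal `fluxVariationBound` of
stmt-NavierStokesRegularity-16855; strategist census gen 1, A-S6 (F1), UNCONDITIONAL). There is a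
universal `K_F < ∞` such that: for every `C⁴` divergence-free field `u` on `ℝ³` and `C¹` scalar `p`
with `‖u‖, ‖Du‖ ≤ C(1+‖x‖)⁻³`, `|p − π₀|, ‖Dp‖ ≤ C(1+‖x‖)⁻²`, `p = p̃[u] + c₀` (the Riesz-transform
pressure of `u` up to a constant — the situation of every time slice of a classical Leray–Hopf
solution from rapidly decaying data, by decay persistence and pressure normalisation), every linear
isometry `R` and all offsets `a, b`, the Bernoulli fluxes `F(R,c) = ∫ (|u|²/2 + p)⟪u, R e₂⟫(R(y₀,y₁,c)) dy`
obey `‖F(R,a) − F(R,b)‖ₑ ≤ K_F · (sup_c ∫⁻ ‖u(R(y₀,y₁,c))‖ₑ² dy)^{1/2} · ∫⁻ ‖Du‖ₑ²`: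
the oscillation of the flux in the offset is at most `K_F √(P_R) Z`. [folklore; RRS2016 Lemma 5.1] -/
theorem fluxVariationBound : ∃ K_F : ℝ≥0∞, K_F ≠ ⊤ ∧ ∀ (u : EuclideanSpace ℝ (Fin 3) → EuclideanSpace ℝ (Fin 3)) (p : EuclideanSpace ℝ (Fin 3) → ℝ) (C π₀ : ℝ), ContDiff ℝ 4 u → ContDiff ℝ 1 p → Literature.Analysis.FluidPDE.VectorCalculus.IsDivFree u → (∀ x, ‖u x‖ ≤ C * (1 + ‖x‖) ^ (-(3 : ℝ))) → (∀ x, ‖fderiv ℝ u x‖ ≤ C * (1 + ‖x‖) ^ (-(3 : ℝ))) → (∀ x, ‖p x - π₀‖ ≤ C * (1 + ‖x‖) ^ (-(2 : ℝ))) → (∀ x, ‖fderiv ℝ p x‖ ≤ C * (1 + ‖x‖) ^ (-(2 : ℝ))) → (∃ c₀ : ℝ, ∀ x, p x = Literature.Analysis.FluidPDE.normalisedPressure u x + c₀) → ∀ (R : EuclideanSpace ℝ (Fin 3) ≃ₗᵢ[ℝ] EuclideanSpace ℝ (Fin 3)) (a b : ℝ), ‖(∫ y : EuclideanSpace ℝ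 (Fin 2), (‖u (R (WithLp.toLp 2 ![y 0, y 1, a]))‖ ^ 2 / 2 + p (R (WithLp.toLp 2 ![y 0, y 1, a]))) * inner ℝ (u (R (WithLp.toLp 2 ![y 0, y 1, a]))) (R (EuclideanSpace.single 2 1))) - (∫ y : EuclideanSpace ℝ (Fin 2), (‖u (R (WithLp.toLp 2 ![y 0, y 1, b]))‖ ^ 2 / 2 + p (R (WithLp.toLp 2 ![y 0, y 1, b]))) * inner ℝ (u (R (WithLp.toLp 2 ![y 0, y 1, b]))) (R (EuclideanSpace.single 2 1)))‖ₑ ≤ K_F * (⨆ c : ℝ, ∫⁻ y : EuclideanSpace ℝ (Fin 2), ‖u (R (WithLp.toLp 2 ![y 0, y 1, c]))‖ₑ ^ 2) ^ (1 / 2 : ℝ) * ∫⁻ x, ‖fderiv ℝ u x‖ₑ ^ 2 := by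
  obtain ⟨K, hKt, hK⟩ := exists_eLpNorm_fderiv_normalisedPressure_le
  exact ⟨1 + K, by simpa using hKt, fun u p C π₀ hu hp hdiv h0 h1 k0 k1 hid R a b =>
    enorm_bernoulliFlux_sub_le_sqrt_planarCeiling_mul hK hu hp hdiv h0 h1 k0 k1 hid R a b⟩

end Summit.NavierStokesRegularity.NavierStokesRegularity.Theorems.PlanarEnergyAPriori

end
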